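import Literature.Barriers.CriticalPhenomena.SrwLawPoissonBessel
import HarnessLib

/-!
# The far-tail law as a pure power `K · m^{-d/2}`

`srwLaw_two_mul_zero_le_farTail` bounds `q_m = p_{2m}(0)` by an explicit Stirling/Debye expression.  Here
it is simplified to `q_m ≤ K(d, λ, M₀) · m^{-d/2}` for all `m ≥ M₀` — the shape consumed by
`summable_choose_mul_of_eventually_le_rpow` (file `SrwISeedTailSummable`), so that the two series
hypotheses of the seed enclosure `srwI_succ_mem_Icc` are discharged for the SEEDCERT-P majorant
(block constants up to `M_END`, far-tail law beyond) whenever `d/2 > n + 1`. [folklore]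
-/

namespace Literature.Barriers.CriticalPhenomena.LongRangePhi4

open Finset Real

variable {d : ℕ}

/-- **(FT′) far tail as a power law.**  For `d ≥ 1`, `0 < λ < 1`, `1 ≤ M₀ ≤ m` and
`η₀ := 2/(√(2π(2M₀+2))(1−λ²)) < 1`:
`q_m ≤ (2 (1 + 25d/(λM₀))^d / ((√(2π·2λ/d))^d (1 − η₀))) · m^{−d/2}`. [folklore] -/
theorem srwLaw_two_mul_zero_le_const_mul_rpow (hd : 1 ≤ d) {lam : ℝ} (h0 : 0 < lam) (h1 : lam < 1)
    {M₀ m : ℕ} (hM : 1 ≤ M₀) (hm : M₀ ≤ m)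
    (hη : 2 / (√(2 * Real.pi * ((2 * (M₀ + 1) : ℕ) : ℝ)) * (1 - lam ^ 2)) < 1) :
    srwLaw d (2 * m) 0 ≤
      2 * (1 + 25 * d / (lam * M₀)) ^ d /
          ((√(2 * Real.pi * (2 * lam / d))) ^ d *
            (1 - 2 / (√(2 * Real.pi * ((2 * (M₀ + 1) : ℕ) : ℝ)) * (1 - lam ^ 2)))) *
        (m : ℝ) ^ (-((d : ℝ) / 2)) := by
  set η0 := 2 / (√(2 * Real.pi * ((2 * (M₀ + 1) : ℕ) : ℝ)) * (1 - lam ^ 2)) with hη0_def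
  set ηm := 2 / (√(2 * Real.pi * ((2 * (m + 1) : ℕ) : ℝ)) * (1 - lam ^ 2)) with hηm_def
  have hd0 : (0 : ℝ) < d := by exact_mod_cast hd
  have hM' : (1 : ℝ) ≤ M₀ := by exact_mod_cast hM
  have hmM : (M₀ : ℝ) ≤ m := by exact_mod_cast hm
  have hm1 : (1 : ℝ) ≤ m := hM'.trans hmM
  have hm0 : (0 : ℝ) < m := by linarith
  have hM0 : (0 : ℝ) < M₀ := by linarith
  have h1l : 0 < 1 - lam ^ 2 := by nlinarith
  have hsq0 : 0 < √(2 * Real.pi * ((2 * (M₀ + 1) : ℕ) : ℝ)) := Real.sqrt_pos.2 (by positivity)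
  -- η is antitone in m
  have hηle : ηm ≤ η0 := by
    rw [hηm_def, hη0_def]
    have hs : √(2 * Real.pi * ((2 * (M₀ + 1) : ℕ) : ℝ)) ≤ √(2 * Real.pi * ((2 * (m + 1) : ℕ) : ℝ)) := by
      apply Real.sqrt_le_sqrt
      have : ((2 * (M₀ + 1) : ℕ) : ℝ) ≤ ((2 * (m + 1) : ℕ) : ℝ) := by exact_mod_cast (by omega)
      nlinarith [Real.pi_pos]
    exact div_le_div_of_nonneg_left (by norm_num) (by positivity)
      (mul_le_mul_of_nonneg_right hs h1l.le)
  have hηm1 : ηm < 1 := lt_of_le_of_lt hηle hη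
  have hη0' : 0 < 1 - η0 := by linarith
  have hηm' : 0 < 1 - ηm := by linarith
  have hFT := srwLaw_two_mul_zero_le_farTail hd (m := m) (by exact_mod_cast (show 1 ≤ m by omega)) h0 h1 hηm1
  refine hFT.trans ?_
  -- abbreviations
  set u := 2 * lam * m / d with hu
  have hu0 : 0 < u := by positivity
  set c := 2 * Real.pi * (2 * lam / d) with hc
  have hc0 : 0 < c := by positivity
  have hcu : 2 * Real.pi * u = c * m := by rw [hu, hc]; ring
  have hsqu : √(2 * Real.pi * u) = √c * √(m : ℝ) := by rw [hcu, Real.sqrt_mul hc0.le]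
  have hsc : 0 < √c := Real.sqrt_pos.2 hc0
  have hsm : 0 < √(m : ℝ) := Real.sqrt_pos.2 hm0
  -- (√m)^d = m^{d/2} and m^{-d/2} = (m^{d/2})⁻¹
  have hsqpow : (√(m : ℝ)) ^ d = (m : ℝ) ^ ((d : ℝ) / 2) := by
    rw [Real.sqrt_eq_rpow, ← Real.rpow_natCast, ← Real.rpow_mul hm0.le]
    congr 1; ring
  have hmpos : 0 < (m : ℝ) ^ ((d : ℝ) / 2) := Real.rpow_pos_of_pos hm0 _
  have hneg : (m : ℝ) ^ (-((d : ℝ) / 2)) = ((m : ℝ) ^ ((d : ℝ) / 2))⁻¹ := Real.rpow_neg hm0.le _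
  -- exp(u)^d = exp(2λm)
  have hexp : Real.exp u ^ d = Real.exp (2 * lam * m) := by
    rw [← Real.exp_nat_mul]; congr 1; rw [hu]; field_simp
  have hE : 0 < Real.exp (2 * lam * m) := Real.exp_pos _
  -- rewrite the FT expression
  have hL : ((1 + 50 / u) * (Real.exp u / √(2 * Real.pi * u))) ^ d / (Real.exp (2 * lam * m) / 2 * (1 - ηm))
      = 2 * (1 + 50 / u) ^ d / ((√c) ^ d * (m : ℝ) ^ ((d : ℝ) / 2) * (1 - ηm)) := by
    rw [mul_pow, div_pow, hexp, hsqu, mul_pow, hsqpow]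
    field_simp
  have hR : 2 * (1 + 25 * d / (lam * M₀)) ^ d / ((√c) ^ d * (1 - η0)) * (m : ℝ) ^ (-((d : ℝ) / 2))
      = 2 * (1 + 25 * d / (lam * M₀)) ^ d / ((√c) ^ d * (m : ℝ) ^ ((d : ℝ) / 2) * (1 - η0)) := by
    rw [hneg]; field_simp
  rw [hL, hR]
  -- compare numerators and denominators
  have hA : 1 + 50 / u ≤ 1 + 25 * d / (lam * M₀) := by
    have h50 : 50 / u = 25 * d / (lam * m) := by rw [hu]; field_simp; ring
    rw [h50]
    have : 25 * (d : ℝ) / (lam * m) ≤ 25 * d / (lam * M₀) :=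
      div_le_div_of_nonneg_left (by positivity) (by positivity) (mul_le_mul_of_nonneg_left hmM h0.le)
    linarith
  have hApow : (1 + 50 / u) ^ d ≤ (1 + 25 * d / (lam * M₀)) ^ d :=
    pow_le_pow_left₀ (by positivity) hA d
  exact div_le_div₀ (by positivity) (by linarith) (by positivity)
    (mul_le_mul_of_nonneg_left (by linarith) (by positivity))

end Literature.Barriers.CriticalPhenomena.LongRangePhi4
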